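import Mathlib

/-!
# Pollard's theorem on representation counts in `ℤ/p`

Sixth support file of the series for route `MatrixMultiplication/EisensteinValCertificates` (cruxes
`stmt-MatrixMultiplication-7788` `PrimeValSaving`, stmt-7790 `PrimeFourThirdsSaving`): a kernel
proof of **Pollard's theorem** (1974), the multiplicity version of Cauchy–Davenport, following
Nathanson, *Additive Number Theory: Inverse Problems and the Geometry of Sumsets*, Thm. 2.4:
for nonempty `A, B ⊆ ℤ/p` and `1 ≤ t ≤ min(#A, #B)`,

  `∑_x min(t, r_{A,B}(x)) ≥ min(t·p, t·(#A + #B − t))`,   `r_{A,B}(x) = #{a ∈ A : x − a ∈ B}`.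

(`t = 1` is Cauchy–Davenport.)  It is the input for the sharp density threshold `1/3` of
trapezoid-free triples at prime modulus (companion file `…PrimeValSavingPrimeThird`): the set of
`ρ`-popular sums `{x : r(x) > ρ}` has at least `#A + #B − t − ρp/t` elements.
[cite: Pollard1974, Thm. 1] [cite: Nathanson1996, Thm. 2.4 (GTM 165)]
-/

-- single-conjunct summit: the mandated namespace repeats `MatrixMultiplication`.
set_option linter.dupNamespace false

namespace Summit.MatrixMultiplication.MatrixMultiplication.Theorems

namespace PrattValPollard

open Finset

section General

variable {G : Type*} [AddCommGroup G] [DecidableEq G]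

/-- `r_{A,B}(x) ≤ #B`: `a ↦ x - a` injects `{a ∈ A : x - a ∈ B}` into `B`. [folklore] -/
theorem repr_le_card (A B : Finset G) (x : G) : #(A.filter fun a => x - a ∈ B) ≤ #B := by
  refine card_le_card_of_injOn (fun a => x - a) (fun a ha => ?_) ?_
  · exact mem_coe.2 (mem_filter.1 (mem_coe.1 ha)).2
  · intro a _ a' _ h
    simpa using h

/-- `r_{A,B}` is symmetric: `#{a ∈ A : x - a ∈ B} = #{b ∈ B : x - b ∈ A}`. [folklore] -/
theorem repr_comm (A B : Finset G) (x : G) :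
    #(A.filter fun a => x - a ∈ B) = #(B.filter fun b => x - b ∈ A) := by
  refine card_bij' (fun a _ => x - a) (fun b _ => x - b) ?_ ?_ ?_ ?_
  · intro a ha
    obtain ⟨ha, hb⟩ := mem_filter.1 ha
    refine mem_filter.2 ⟨hb, ?_⟩
    have : x - (x - a) = a := by abel
    rw [this]; exact ha
  · intro b hb
    obtain ⟨hb, ha⟩ := mem_filter.1 hb
    refine mem_filter.2 ⟨ha, ?_⟩
    have : x - (x - b) = b := by abel
    rw [this]; exact hb
  · intro a _; abel
  · intro b _; abel

/-- Monotonicity in `B`. [folklore] -/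
theorem repr_mono {B B' : Finset G} (h : B' ⊆ B) (A : Finset G) (x : G) :
    #(A.filter fun a => x - a ∈ B') ≤ #(A.filter fun a => x - a ∈ B) :=
  card_le_card (fun a ha => by
    obtain ⟨ha, hb⟩ := mem_filter.1 ha
    exact mem_filter.2 ⟨ha, h hb⟩)

/-- Translating `B` shifts the representation function: `r_{A, B + c}(x) = r_{A,B}(x - c)`.
[folklore] -/
theorem repr_image_add (A B : Finset G) (c x : G) :
    #(A.filter fun a => x - a ∈ B.image (· + c)) = #(A.filter fun a => x - c - a ∈ B) := by
  congr 1
  ext a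
  simp only [mem_filter, mem_image]
  constructor
  · rintro ⟨ha, b, hb, hbe⟩
    refine ⟨ha, ?_⟩
    have : x - c - a = b := by rw [eq_sub_of_add_eq hbe]; abel
    rw [this]; exact hb
  · rintro ⟨ha, hb⟩
    exact ⟨ha, x - c - a, hb, by abel⟩

/-- **The `U, I` decomposition** (Nathanson, proof of Thm. 2.4):
`r_{A,B}(x) = r_{A ∪ B, A ∩ B}(x) + r_{A \ B, B \ A}(x)`. [cite: Nathanson1996, proof of Thm. 2.4] -/
theorem repr_eq_union_inter_add (A B : Finset G) (x : G) :
    #(A.filter fun a => x - a ∈ B) =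
      #((A ∪ B).filter fun u => x - u ∈ A ∩ B) + #((A \ B).filter fun a => x - a ∈ B \ A) := by
  -- split `{a ∈ A : x - a ∈ B}` by `a ∈ B`, `x - a ∈ A`
  have h1 : #(A.filter fun a => x - a ∈ B) =
      #((A \ B).filter fun a => x - a ∈ B \ A) + #((A \ B).filter fun a => x - a ∈ A ∩ B) +
      #((A ∩ B).filter fun a => x - a ∈ B) := by
    rw [← card_union_of_disjoint, ← card_union_of_disjoint]
    · congr 1
      ext a
      simp only [mem_filter, mem_union, mem_sdiff, mem_inter]
      tauto
    · rw [disjoint_left]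
      intro a ha ha'
      simp only [mem_union, mem_filter, mem_sdiff, mem_inter] at ha ha'
      tauto
    · rw [disjoint_left]
      intro a ha ha'
      simp only [mem_filter, mem_sdiff, mem_inter] at ha ha'
      tauto
  have h2 : #((A ∪ B).filter fun u => x - u ∈ A ∩ B) =
      #((A \ B).filter fun a => x - a ∈ A ∩ B) + #((B \ A).filter fun u => x - u ∈ A ∩ B) +
      #((A ∩ B).filter fun u => x - u ∈ A ∩ B) := by
    rw [← card_union_of_disjoint, ← card_union_of_disjoint]
    · congr 1
      ext a
      simp only [mem_filter, mem_union, mem_sdiff, mem_inter]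
      tauto
    · rw [disjoint_left]
      intro a ha ha'
      simp only [mem_union, mem_filter, mem_sdiff, mem_inter] at ha ha'
      tauto
    · rw [disjoint_left]
      intro a ha ha'
      simp only [mem_filter, mem_sdiff, mem_inter] at ha ha'
      tauto
  -- `{u ∈ B \ A : x - u ∈ A ∩ B}` ↔ `{a ∈ A ∩ B : x - a ∈ B \ A}` via `u ↦ x - u`
  have h3 : #((B \ A).filter fun u => x - u ∈ A ∩ B) =
      #((A ∩ B).filter fun a => x - a ∈ B \ A) := by
    refine card_bij' (fun u _ => x - u) (fun a _ => x - a) ?_ ?_ ?_ ?_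
    · intro u hu
      obtain ⟨hu, hv⟩ := mem_filter.1 hu
      refine mem_filter.2 ⟨hv, ?_⟩
      have : x - (x - u) = u := by abel
      rw [this]; exact hu
    · intro a ha
      obtain ⟨ha, hv⟩ := mem_filter.1 ha
      refine mem_filter.2 ⟨hv, ?_⟩
      have : x - (x - a) = a := by abel
      rw [this]; exact ha
    · intro u _; abel
    · intro a _; abel
  -- `{a ∈ A ∩ B : x - a ∈ B}` splits by `x - a ∈ A`
  have h4 : #((A ∩ B).filter fun a => x - a ∈ B) =
      #((A ∩ B).filter fun a => x - a ∈ B \ A) + #((A ∩ B).filter fun u => x - u ∈ A ∩ B) := by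
    rw [← card_union_of_disjoint]
    · congr 1
      ext a
      simp only [mem_filter, mem_union, mem_sdiff, mem_inter]
      tauto
    · rw [disjoint_left]
      intro a ha ha'
      simp only [mem_filter, mem_sdiff, mem_inter] at ha ha'
      tauto
  omega


variable [Fintype G]

/-- `∑_x r_{A,B}(x) = #A · #B`. [folklore] -/
theorem sum_repr (A B : Finset G) : ∑ x, #(A.filter fun a => x - a ∈ B) = #A * #B := by
  calc ∑ x, #(A.filter fun a => x - a ∈ B)
      = ∑ x, ∑ a ∈ A, if x - a ∈ B then 1 else 0 := by
        refine sum_congr rfl fun x _ => ?_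
        rw [card_filter]
    _ = ∑ a ∈ A, ∑ x, if x - a ∈ B then 1 else 0 := sum_comm
    _ = ∑ a ∈ A, #B := by
        refine sum_congr rfl fun a _ => ?_
        rw [← card_filter]
        refine card_bij' (fun x _ => x - a) (fun b _ => b + a) ?_ ?_ ?_ ?_
        · intro x hx; exact (mem_filter.1 hx).2
        · intro b hb
          refine mem_filter.2 ⟨mem_univ _, ?_⟩
          have : b + a - a = b := by abel
          rw [this]; exact hb
        · intro x _; abel
        · intro b _; abel
    _ = #A * #B := by rw [sum_const, smul_eq_mul]

/-- Translation invariance of `∑_x min(t, r_{A,B}(x))` in `B`. [folklore] -/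
theorem sum_min_repr_image_add (A B : Finset G) (c : G) (t : ℕ) :
    ∑ x, min t #(A.filter fun a => x - a ∈ B.image (· + c)) =
      ∑ x, min t #(A.filter fun a => x - a ∈ B) := by
  simp_rw [repr_image_add]
  exact Fintype.sum_equiv (Equiv.subRight c) _ _ fun x => rfl

end General

/-! ### Pollard's theorem -/

section Prime

variable {p : ℕ} [hp : Fact p.Prime]

/-- In `ℤ/p`, a set closed under a non-zero translation is everything. [folklore] -/
theorem eq_univ_of_add_mem {A : Finset (ZMod p)} (hA : A.Nonempty) {d : ZMod p} (hd : d ≠ 0)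
    (h : ∀ a ∈ A, a + d ∈ A) : A = univ := by
  obtain ⟨a, ha⟩ := hA
  have hn : ∀ n : ℕ, a + n • d ∈ A := by
    intro n
    induction n with
    | zero => simpa using ha
    | succ n ih =>
      have := h _ ih
      rwa [add_assoc, ← succ_nsmul] at this
  refine eq_univ_of_forall fun x => ?_
  have key := hn ((x - a) * d⁻¹).val
  rwa [nsmul_eq_mul, ZMod.natCast_zmod_val, inv_mul_cancel_right₀ hd, add_sub_cancel] at key

/-- **Pollard's theorem** (1974), in the normalisation `#B ≤ #A`: for nonempty `A, B ⊆ ℤ/p` and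
`1 ≤ t ≤ #B ≤ #A`, `min(t·p, t·(#A + #B − t)) ≤ ∑_x min(t, r_{A,B}(x))`.
Proof by induction on `#B` via the `U = A ∪ B`, `I = A ∩ B` decomposition (Nathanson Thm. 2.4).
[cite: Pollard1974, Thm. 1] [cite: Nathanson1996, Thm. 2.4] -/
theorem pollard_of_card_le :
    ∀ (n : ℕ) (A B : Finset (ZMod p)), #B = n → n ≤ #A → ∀ t : ℕ, 1 ≤ t → t ≤ n →
      min (t * p) (t * (#A + n - t)) ≤ ∑ x, min t #(A.filter fun a => x - a ∈ B) := by
  intro n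
  induction n using Nat.strong_induction_on with
  | _ n ih =>
  intro A B hBn hnA t ht1 htn
  -- the case `t = n`: every `r ≤ n`, so the sum is `#A · n`
  rcases eq_or_lt_of_le htn with rfl | htn'
  · have hsum : ∑ x, min (#B) #(A.filter fun a => x - a ∈ B) = #A * #B := by
      rw [← sum_repr A B]
      exact sum_congr rfl fun x _ => min_eq_right (repr_le_card A B x)
    rw [hBn] at hsum
    rw [hsum, Nat.add_sub_cancel]
    exact (min_le_right _ _).trans (Nat.mul_comm t #A).le
  -- now `1 ≤ t < n`, so `n ≥ 2`
  have hn2 : 2 ≤ n := by omega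
  have hAp : #A ≤ p := (card_le_univ _).trans (ZMod.card p).le
  by_cases hbig : p + t < #A + n
  · -- reduce `B` to a subset of size `ℓ' = p + t - #A`
    have hl' : p + t - #A < n := by omega
    have hl'B : p + t - #A ≤ #B := by omega
    obtain ⟨B', hB'B, hB'card⟩ := exists_subset_card_eq hl'B
    have hA' : A.Nonempty := card_pos.1 (by omega)
    have key := ih (p + t - #A) hl' A B' hB'card (by omega) t ht1 (by omega)
    have hmin : min (t * p) (t * (#A + (p + t - #A) - t)) = t * p := by
      rw [show #A + (p + t - #A) - t = p by omega, min_self]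
    rw [hmin] at key
    calc min (t * p) (t * (#A + n - t)) ≤ t * p := min_le_left _ _
      _ ≤ ∑ x, min t #(A.filter fun a => x - a ∈ B') := key
      _ ≤ ∑ x, min t #(A.filter fun a => x - a ∈ B) :=
          sum_le_sum fun x _ => min_le_min_left _ (repr_mono hB'B A x)
  · rw [not_lt] at hbig
    -- main case `#A + n ≤ p + t`; then `#A < p`
    have hAlt : #A < p := by omega
    -- two distinct elements of `B`
    have hB1 : 1 < #B := by omega
    obtain ⟨b, hb, b', hb', hbb'⟩ := one_lt_card.1 hB1
    have hd : b' - b ≠ 0 := sub_ne_zero.2 (Ne.symm hbb')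
    -- some `a* ∈ A` with `a* + (b' - b) ∉ A`
    have hA0 : A.Nonempty := card_pos.1 (by omega)
    have hex : ∃ a ∈ A, a + (b' - b) ∉ A := by
      by_contra hcon
      push Not at hcon
      have := eq_univ_of_add_mem hA0 hd hcon
      rw [this, card_univ, ZMod.card] at hAlt
      exact lt_irrefl _ hAlt
    obtain ⟨a₀, ha₀, ha₀d⟩ := hex
    -- translate `B` by `a₀ - b`
    set B₁ := B.image (· + (a₀ - b)) with hB₁
    have hB₁card : #B₁ = n := by
      rw [hB₁, card_image_of_injective _ (add_left_injective _), hBn]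
    have hS : ∑ x, min t #(A.filter fun a => x - a ∈ B₁) =
        ∑ x, min t #(A.filter fun a => x - a ∈ B) := sum_min_repr_image_add A B _ t
    rw [← hS]
    have ha₀B₁ : a₀ ∈ B₁ := mem_image.2 ⟨b, hb, by abel⟩
    have hdB₁ : a₀ + (b' - b) ∈ B₁ := mem_image.2 ⟨b', hb', by abel⟩
    -- `U = A ∪ B₁`, `I = A ∩ B₁`
    set U := A ∪ B₁ with hU
    set I := A ∩ B₁ with hI
    have hUI : #U + #I = #A + n := by rw [hU, hI, card_union_add_card_inter, hB₁card]
    have hI1 : 1 ≤ #I := card_pos.2 ⟨a₀, mem_inter.2 ⟨ha₀, ha₀B₁⟩⟩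
    have hIn : #I < n := by
      rw [← hB₁card]
      refine card_lt_card ⟨inter_subset_right, fun hsub => ha₀d ?_⟩
      exact (mem_inter.1 (hsub hdB₁)).1
    have hIU : #I ≤ #U := card_le_card (inter_subset_left.trans subset_union_left)
    have hdec : ∀ x, #(A.filter fun a => x - a ∈ B₁) =
        #(U.filter fun u => x - u ∈ I) + #((A \ B₁).filter fun a => x - a ∈ B₁ \ A) :=
      fun x => repr_eq_union_inter_add A B₁ x
    by_cases htI : t ≤ #I
    · -- induction for `(U, I)`
      have key := ih (#I) hIn U I rfl hIU t ht1 htI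
      rw [hUI] at key
      refine key.trans (sum_le_sum fun x _ => min_le_min_left _ ?_)
      rw [hdec x]
      exact Nat.le_add_right _ _
    · rw [not_le] at htI
      -- induction for `(A \ B₁, B₁ \ A)` with `t' = t - #I`
      have hB'card : #(B₁ \ A) = n - #I := by
        have := card_sdiff_add_card_inter B₁ A
        rw [inter_comm, ← hI, hB₁card] at this
        omega
      have hA'card : #(A \ B₁) = #A - #I := by
        have := card_sdiff_add_card_inter A B₁
        rw [← hI] at this
        omega
      have key := ih (n - #I) (by omega) (A \ B₁) (B₁ \ A) hB'card (by omega) (t - #I)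
        (by omega) (by omega)
      have hmin : min ((t - #I) * p) ((t - #I) * (#(A \ B₁) + (n - #I) - (t - #I))) =
          (t - #I) * (#U - t) := by
        rw [hA'card]
        have h1 : #A - #I + (n - #I) - (t - #I) = #U - t := by omega
        rw [h1]
        refine min_eq_right (Nat.mul_le_mul_left _ ?_)
        have : #U ≤ p := (card_le_univ _).trans (ZMod.card p).le
        omega
      rw [hmin] at key
      -- pointwise: `min t (r_{U,I} + r') ≥ r_{U,I} + min (t - #I) r'` since `r_{U,I} ≤ #I`
      have hpt : ∀ x, #(U.filter fun u => x - u ∈ I) +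
          min (t - #I) #((A \ B₁).filter fun a => x - a ∈ B₁ \ A) ≤
          min t #(A.filter fun a => x - a ∈ B₁) := by
        intro x
        rw [hdec x]
        have := repr_le_card U I x
        rcases le_total (t - #I) #((A \ B₁).filter fun a => x - a ∈ B₁ \ A) with h | h
        · rw [min_eq_left h]
          apply le_min <;> omega
        · rw [min_eq_right h]
          apply le_min <;> omega
      have hsumUI : ∑ x, #(U.filter fun u => x - u ∈ I) = #U * #I := sum_repr U I
      calc min (t * p) (t * (#A + n - t)) ≤ t * (#A + n - t) := min_le_right _ _
        _ = #U * #I + (t - #I) * (#U - t) := by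
            rw [← hUI]
            have h1 : #I < t := htI
            have h2 : t ≤ #U := by omega
            zify [h1.le, h2, (by omega : t ≤ #U + #I)]
            ring
        _ ≤ ∑ x, #(U.filter fun u => x - u ∈ I) +
              ∑ x, min (t - #I) #((A \ B₁).filter fun a => x - a ∈ B₁ \ A) := by
            rw [hsumUI]; exact Nat.add_le_add_left key _
        _ = ∑ x, (#(U.filter fun u => x - u ∈ I) +
              min (t - #I) #((A \ B₁).filter fun a => x - a ∈ B₁ \ A)) := (sum_add_distrib).symm
        _ ≤ ∑ x, min t #(A.filter fun a => x - a ∈ B₁) := sum_le_sum fun x _ => hpt x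

/-- **Pollard's theorem** (1974): for nonempty `A, B ⊆ ℤ/p` (`p` prime) and
`1 ≤ t ≤ min(#A, #B)`: `min(t·p, t·(#A + #B − t)) ≤ ∑_x min(t, #{a ∈ A : x − a ∈ B})`.
The case `t = 1` is the Cauchy–Davenport theorem. [cite: Pollard1974, Thm. 1] [cite: Nathanson1996, Thm. 2.4] -/
theorem pollard (A B : Finset (ZMod p)) {t : ℕ} (ht : 1 ≤ t) (htA : t ≤ #A) (htB : t ≤ #B) :
    min (t * p) (t * (#A + #B - t)) ≤ ∑ x, min t #(A.filter fun a => x - a ∈ B) := by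
  rcases le_total #B #A with h | h
  · exact pollard_of_card_le #B A B rfl h t ht htB
  · have key := pollard_of_card_le #A B A rfl h t ht htA
    rw [Nat.add_comm #B #A] at key
    refine key.trans (le_of_eq (sum_congr rfl fun x _ => ?_))
    rw [repr_comm]

/-- **Popular sums are many** (consequence of Pollard): for `A, B ⊆ ℤ/p`, `1 ≤ t ≤ min(#A,#B)`,
any `ρ`, and `#A + #B ≤ p + t`, the set of `x` with more than `ρ` representations satisfies
`t·(#A + #B − t) ≤ t·#{x : ρ < r(x)} + ρ·p`. [cite: Pollard1974, Thm. 1] [cite: Nathanson1996, Thm. 2.4] -/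
theorem card_popular_ge (A B : Finset (ZMod p)) {t ρ : ℕ} (ht : 1 ≤ t) (htA : t ≤ #A)
    (htB : t ≤ #B) (hsum : #A + #B ≤ p + t) :
    t * (#A + #B - t) ≤
      t * #((univ : Finset (ZMod p)).filter fun x => ρ < #(A.filter fun a => x - a ∈ B)) + ρ * p := by
  have key := pollard A B ht htA htB
  rw [min_eq_right (Nat.mul_le_mul_left _ (by omega))] at key
  refine key.trans ?_
  -- split the sum into popular and unpopular `x`
  set P := (univ : Finset (ZMod p)).filter fun x => ρ < #(A.filter fun a => x - a ∈ B) with hP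
  have hsplit : ∑ x, min t #(A.filter fun a => x - a ∈ B) =
      ∑ x ∈ P, min t #(A.filter fun a => x - a ∈ B) +
      ∑ x ∈ univ.filter (fun x => ¬ ρ < #(A.filter fun a => x - a ∈ B)),
        min t #(A.filter fun a => x - a ∈ B) := by
    rw [hP, sum_filter_add_sum_filter_not]
  rw [hsplit]
  refine Nat.add_le_add ?_ ?_
  · calc ∑ x ∈ P, min t #(A.filter fun a => x - a ∈ B) ≤ ∑ x ∈ P, t :=
          sum_le_sum fun x _ => min_le_left _ _
      _ = t * #P := by rw [sum_const, smul_eq_mul, Nat.mul_comm]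
  · calc ∑ x ∈ univ.filter (fun x => ¬ ρ < #(A.filter fun a => x - a ∈ B)),
          min t #(A.filter fun a => x - a ∈ B)
        ≤ ∑ x ∈ univ.filter (fun x => ¬ ρ < #(A.filter fun a => x - a ∈ B)), ρ :=
          sum_le_sum fun x hx => (min_le_right _ _).trans (not_lt.1 (mem_filter.1 hx).2)
      _ = ρ * #(univ.filter (fun x => ¬ ρ < #(A.filter fun a => x - a ∈ B))) := by
          rw [sum_const, smul_eq_mul, Nat.mul_comm]
      _ ≤ ρ * p := Nat.mul_le_mul_left _ ((card_le_univ _).trans (ZMod.card p).le)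

end Prime

end PrattValPollard

end Summit.MatrixMultiplication.MatrixMultiplication.Theorems
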